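import Summits.FinalStateConjecture.FinalStateConjecture.Theses.TemporalBandLiouville
import HarnessLib.Audit

/-!
# Line `kerr-seam-split` for crux `TemporalBandLiouville.StationaryLimitReduction` (stmt-FinalStateConjecture-10173)

The TYPED DECOMPOSITION of the crux (crux-strategist seat planner-cstrat-stmt-FinalStateConjecture-10173-r1-0,
route re-audit bin RESTATED → BC2 redirect, 2026-08-17), registered as a line of the parent so that the three pieces
— now ITEMS of route `TemporalBandLiouville` (rev 3, commit 09eae4c2) — are in the skeleton-aware cone of `closes`:

* `stub_kerrExteriorsSettle`          = route decl `KerrExteriorsSettle` (item 18039, crux r6) BY NAME;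
* `stub_stationaryHarmonicExteriorIsKerr` = route decl `StationaryHarmonicExteriorIsKerr` (item 18040, crux r5) BY NAME;
* `stub_genericCensoredCapture`       = route decl `GenericCensoredCapture` (item 17308, crux r7 — the SHARED
  `EternalPapapetrou` item, same normalised signature) BY NAME;

and the composition `StationaryLimitReduction_of` (sorry-free) is the split glue
`KerrExteriorsSettle → StationaryHarmonicExteriorIsKerr → GenericCensoredCapture → StationaryLimitReduction`
(also filed as the support item `StationaryLimitReductionOfSplit`, 18041, with this proof attached as evidence for a
prover to land under `Theorems/`). It supersedes, for staffing purposes, the birth skeleton `Lines/birth.lean` of this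
item (stubs `X → U → T`, `U` = EP item 10745 — since flagged refuted-MISSTATED by three refuters —, `G`): the
rigidity input is re-typed in X's own harmonic presentation (`StationaryHarmonicExteriorIsKerr`, no `docOfEnd`), and
the ω-limit transfer is re-typed as the CONDITIONAL pointwise settling statement `KerrExteriorsSettle`
("every member of X's class is an embedded Kerr piece ⇒ T"), whose antecedent X and the rigidity piece discharge.

Why three pieces and why these: `StationaryLimitReduction = X → S` is, given X, the summit itself; its honest content
is (i) stability in the large / LaSalle in comoving harmonic gauge (P1), (ii) smooth no-hair for the stationary
limits X produces (P2), (iii) the generic side — weak cosmic censorship in tame form and the `C⁰ ⇒ C²` sub-extremal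
upgrade (P3) — joined by the certified `EternalPapapetrou` seam (tame genericity is monotone in the property).
BC2(c) probes (seat folder `bc/<Piece>_probe.lean`, route module imported, piece inlined, 400 000 heartbeats,
`first | exact? | simpa [P] | (unfold P; simpa) | aesop` and `first | exact? | simpa | aesop`): `Pᵢ → FinalStateConjecture`
and `Pᵢ → StationaryLimitReduction` FAIL for all three pieces (rc 1, 5/5 errors per file: `whnf` timeouts for the
unfolding forms, `unsolved goals` + "aesop: failed to prove the goal after exhaustive search" for the plain forms); the
converse `FinalStateConjecture → Pᵢ` also fails cheaply for all three (for P3 it is TRUE by monotonicity — P3 is a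
consequence of the summit used toward it — but not found by the probe). No landed theorem of shape `Pᵢ → S`,
`S ↔ Pᵢ`, `Pᵢ → StationaryLimitReduction`; no `summit_equivalent` flag on 17308 / 18039 / 18040.
Plans (d): P3 — registered skeleton `Cruxes/GenericCensoredCapture/Lines/birth.lean` (5 stubs); P1, P2 — birth
skeletons `Cruxes/KerrExteriorsSettle/Lines/birth.lean` (LaSalle dichotomy in harmonic gauge + horizonless Liouville)
and `Cruxes/StationaryHarmonicExteriorIsKerr/Lines/birth.lean` (second Killing field + axisymmetric uniqueness),
registered by this seat.
-/

set_option linter.dupNamespace false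

namespace Summit.FinalStateConjecture.FinalStateConjecture.Cruxes.StationaryLimitReduction.TemporalBandLiouvilleKerrSeam

open Summit.FinalStateConjecture.FinalStateConjecture.Theses

/-! ## The three registered stubs = the three pieces BY NAME -/

/-- **Registered stub 1 — P1 `KerrExteriorsSettle` (item 18039) by name.** Conditional pointwise `C⁰` settling:
every member of X's class an embedded Kerr piece ⇒ every complete-`𝓘⁺` MGHD of admissible data settles in `C⁰`. -/
theorem stub_kerrExteriorsSettle : Summit.FinalStateConjecture.FinalStateConjecture.Theses.TemporalBandLiouville.KerrExteriorsSettle := by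
  sorry

/-- **Registered stub 2 — P2 `StationaryHarmonicExteriorIsKerr` (item 18040) by name.** Smooth no-hair in X's own
harmonic presentation: `t`-independent members of X's class are embedded Kerr pieces. -/
theorem stub_stationaryHarmonicExteriorIsKerr : Summit.FinalStateConjecture.FinalStateConjecture.Theses.TemporalBandLiouville.StationaryHarmonicExteriorIsKerr := by
  sorry

/-- **Registered stub 3 — P3 `GenericCensoredCapture` (item 17308, shared with `EternalPapapetrou`) by name.**
Tame-generic censored capture: MGHD existence, complete `𝓘⁺`, `C⁰ ⇒ C²` sub-extremal upgrade. -/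
theorem stub_genericCensoredCapture : Summit.FinalStateConjecture.FinalStateConjecture.Theses.TemporalBandLiouville.GenericCensoredCapture := by
  sorry

/-! ## Registered stub signatures (by name) -/
namespace Registered

/-- Registered signature of `stub_kerrExteriorsSettle` (verbatim). -/
abbrev stub_kerrExteriorsSettle : Prop := Summit.FinalStateConjecture.FinalStateConjecture.Theses.TemporalBandLiouville.KerrExteriorsSettle

/-- Registered signature of `stub_stationaryHarmonicExteriorIsKerr` (verbatim). -/
abbrev stub_stationaryHarmonicExteriorIsKerr : Prop := Summit.FinalStateConjecture.FinalStateConjecture.Theses.TemporalBandLiouville.StationaryHarmonicExteriorIsKerr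

/-- Registered signature of `stub_genericCensoredCapture` (verbatim). -/
abbrev stub_genericCensoredCapture : Prop := Summit.FinalStateConjecture.FinalStateConjecture.Theses.TemporalBandLiouville.GenericCensoredCapture

end Registered

example : Registered.stub_kerrExteriorsSettle := stub_kerrExteriorsSettle
example : Registered.stub_stationaryHarmonicExteriorIsKerr := stub_stationaryHarmonicExteriorIsKerr
example : Registered.stub_genericCensoredCapture := stub_genericCensoredCapture

/-! ## The composition = the split glue, BY NAME (no `sorry`) -/

/-- **`StationaryLimitReduction` from the three pieces** — the glue `StationaryLimitReductionOfSplit` proved: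
given `hX : EternalExteriorStationary`, every member of X's class is `t`-independent (hX) hence an embedded Kerr
piece (P2), so P1 yields the pointwise `C⁰` settling theorem; tame Christodoulou-genericity of codimension `1` is
monotone in the property, and pointwise on admissible data P3 upgrades the `C⁰` decomposition to the Statement's
sub-extremal `C²` one, threading `RaysStayInClosure` / `HasExhaustiveCharts` / `IsFutureOriented`. -/
theorem StationaryLimitReduction_of
    (h₁ : Registered.stub_kerrExteriorsSettle) (h₂ : Registered.stub_stationaryHarmonicExteriorIsKerr)
    (h₃ : Registered.stub_genericCensoredCapture) :
    Summit.FinalStateConjecture.FinalStateConjecture.Theses.TemporalBandLiouville.StationaryLimitReduction := by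
  intro hX X i₁ i₂ i₃ i₄ i₅ i₆
  -- every member of X's class is t-independent (X) hence Kerr (P2); P1 then gives T
  have hT := h₁ (fun a r₀ G h => h₂ a r₀ G h (hX a r₀ G h))
  -- TAME Christodoulou-genericity (codimension 1, one fixed end) is monotone in the property
  have mono : ∀ {P Q : _ → Prop},
      (∀ D ∈ Literature.Geometry.Lorentzian.admissibleVacuumData X, Q D → P D) →
      Literature.Geometry.Lorentzian.InitialDataSet.IsTameChristodoulouGeneric
        (Literature.Geometry.Lorentzian.admissibleVacuumData X) Q 1 →
      Literature.Geometry.Lorentzian.InitialDataSet.IsTameChristodoulouGeneric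
        (Literature.Geometry.Lorentzian.admissibleVacuumData X) P 1 := by
    intro P Q hQP hQ D hD
    obtain ⟨e, F, htame, himm, h0, hinj, hadm, hexc⟩ :=
      hQ D ⟨hD.1, fun h => hD.2 (hQP D hD.1 h)⟩
    exact ⟨e, F, htame, himm, h0, hinj, hadm,
      fun c hc hmem => hexc c hc ⟨hmem.1, fun h => hmem.2 (hQP _ hmem.1 h)⟩⟩
  refine mono ?_ (h₃ X)
  intro D hD hQ
  obtain ⟨hex, hQ'⟩ := hQ
  refine ⟨hex, fun 𝒟 hmax => ?_⟩
  obtain ⟨hcomp, hup⟩ := hQ' 𝒟 hmax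
  obtain ⟨O, d₀, hO, hrays, hexh, hfut⟩ := hT X D hD 𝒟 hmax hcomp
  obtain ⟨O', d, hsub, hO', hrays', hexh', hfut'⟩ := hup O d₀ hO hrays hexh hfut
  exact ⟨hcomp, O', d, hsub, hO', hrays', hexh', hfut'⟩

/-- The same, stated as the route's glue support item `StationaryLimitReductionOfSplit` (item 18041) BY NAME. -/
theorem stationaryLimitReductionOfSplit_holds : Summit.FinalStateConjecture.FinalStateConjecture.Theses.TemporalBandLiouville.StationaryLimitReductionOfSplit :=
  fun h₁ h₂ h₃ => StationaryLimitReduction_of h₁ h₂ h₃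

end Summit.FinalStateConjecture.FinalStateConjecture.Cruxes.StationaryLimitReduction.TemporalBandLiouvilleKerrSeam
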